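import Summits.BirchSwinnertonDyer.Rank1Residual.ManinAdditive.HesseOptimalityAtThreeSplit
import Summits.BirchSwinnertonDyer.BirchSwinnertonDyer.Theorems.ManinLocalTwoThreeShimuraIndexDichotomy
import Summits.BirchSwinnertonDyer.Rank1Residual.X2.TorsionForcesSplit
import Summits.BirchSwinnertonDyer.BirchSwinnertonDyer.Theorems.ManinLocalTwoThreeThreeTorsionGeomPoint
import Summits.BirchSwinnertonDyer.BirchSwinnertonDyer.Theorems.ManinLocalTwoThreeThreeTorsionTangentSlope
import Literature.NumberTheory.EllipticCurves.EisensteinCongruenceRationalTorsionProofs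
import Literature.NumberTheory.EllipticCurves.LFunctionPrimeCoeffMultiplicative
import Literature.NumberTheory.EllipticCurves.AtkinLehnerInvolutionsNewformProofs
import Literature.NumberTheory.EllipticCurves.AtkinLehnerInvolutionsProofs
import Literature.NumberTheory.EllipticCurves.RootNumberAtkinLehnerSemistableProofs
import Literature.NumberTheory.EllipticCurves.RootNumberTwistProofs
import Literature.NumberTheory.EllipticCurves.BSDInvariantsProofs
import Literature.NumberTheory.EllipticCurves.MazurTorsionOrderValuationProofs
import Literature.NumberTheory.EllipticCurves.GlobalMinimalModelProofs
import HarnessLib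

/-!
# At `3 ∥ N` NO elliptic newform has a Shimura `3`-kernel — `ShimuraIndexPrimeToThreeAtMultiplicativeThree` and the local sign lemma
# E-an-226♮ `ThreeTorsionSignAtThree` are THEOREMS, unconditionally (cell `bsd-f2-manin`; an g40 FILE M `ManinAdditive/HesseOptimalityAtThree.lean`;
# bears on crux C3 `ManinPrimeToThreeAtNine`, stmt-BirchSwinnertonDyer-22968, through an's E-an-222ₒ chain; prover p2 gen 19)

Summit `BirchSwinnertonDyer`, route `ManinLocalTwoThree`; deciding theorem of the line = C3
`Summit.BirchSwinnertonDyer.BirchSwinnertonDyer.Theses.ManinLocalTwoThree.ManinPrimeToThreeAtNine` (NOT proved here; C3 lives at `9 ∣ N`,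
this file settles the complementary `3 ∥ N` nodes of an's analysis).

an g40 typed (FILE M, T-an-52) the restriction node `HesseOptimality.ShimuraIndexPrimeToThreeAtMultiplicativeThree` («`3 ∥ N`: Shimura index
prime to `3` for EVERY modular parametrisation datum, no optimality») as «closed modulo the two local sign lemmas» E-an-226 `MuThreeSignAtThree` and
E-an-226♮ `ThreeTorsionSignAtThree` (`HesseOptimalityAtThreeSplit.shimuraIndexPrimeToThreeAtMultiplicativeThree_of_signLemmas`); ref1 §R195 located
«the ONE gap: Tate-uniformisation of `W[3]|G_ℚ₃` at `3 ∥ N`».  That gap is ALREADY FILLED in the tree by the `b2b-bsdres` cell's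
`X11b.LocalTorsion` / `X2.TorsionForcesSplit` (`E(ℚ₃)[3] = 0` at a non-split multiplicative `3`: `#Ẽ_ns(𝔽₃) = 4`, `Φ ≤ ℤ/2`, `Ê(3ℤ₃)`
torsion-free; rational `3`-torsion anywhere in the isogeny class ⟹ SPLIT), and Katz's theorem is a tree theorem
(`exists_isogeny_addOrderOf_eq_of_forall_exists_smul_eq`).  Hence, with NO new fact and NO sign-lemma hypothesis:

* §1 `hasSplitMultiplicativeReductionAtPrime_three_of_forall_exists_smul_eq` — if every `σ ∈ Γ_ℚ` fixes a non-zero point of `W[3]` and `W`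
  is multiplicative at `3`, the reduction is SPLIT (Katz ⟹ an isogenous curve with a rational point of order `3`; its global minimal model;
  `X2.hasSplitMultiplicativeReductionAtPrime_of_isIsogenous_of_dvd_torsionOrder`);
  `hasSplitMultiplicativeReductionAtPrime_three_of_not_shimuraIndexPrimeTo` — a Shimura `3`-kernel (`¬ ShimuraIndexPrimeTo 3 f`) gives the fixed
  points through the Eisenstein congruences `a_ℓ ≡ ℓ + 1 (mod 3)` (LEAD p1 g9 `dvd_frobeniusTrace_sub_of_not_shimuraIndexPrimeTo` +
  `forall_exists_smul_eq_of_frobeniusTrace_congr`);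
  `hasMultiplicativeReductionAtPrime_three_of_three_exactly_dvd_level` — `3 ∥ N` (LEVEL) ⟹ multiplicative at `3`, Carayol-free: `3 ∣ N ⟹ 3 ∣ N(W)`
  (`IsNewformOf.dvd_level_iff_dvd_conductorNorm`), and additive reduction would give `a₃(W) = 0` while `a₃(f) = −λ₃(f) = ∓1`
  (`IsNewform0.atkinLehnerEigenvalueAt_eq_neg_coeff_of_not_dvd` / `…_eq_one_or_eq_neg_one`);
  `atkinLehnerEigenvalueAt_three_eq_neg_one_of_split` — split ⟹ `a₃ = +1` (`LFunction_apply_prime_of_hasSplitMultiplicativeReductionAtPrime`) ⟹ `λ₃ = −1`.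
* §2 **E-an-226♮ `threeTorsionSignAtThree_holds : ThreeTorsionSignAtThree`** — `3 ∥ N` and a rational point of order `3` on the short model
  `E_{W,c}` ⟹ `λ₃(f) = −1` (rescaling `isShortThreeTorsion_one_of_isShortThreeTorsion` to `c = 1`, the tree's rational order-`3` point
  `exists_geomPoint_of_isShortThreeTorsion` as the fixed vector, §1).
* §3 **`shimuraIndexPrimeToThreeAtMultiplicativeThree_holds : ShimuraIndexPrimeToThreeAtMultiplicativeThree`** — at `3 ∥ N` a Shimura `3`-kernel
  would force `λ₃ = −1` (§1), and es's THEOREM AL₍₃₎ `shimuraIndexPrimeTo_of_atkinLehnerEigenvalueAt_eq_neg_one` (`27 ∤ N`) then gives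
  `3 ∤ [Λ₀(f) : Λ₁(f)]` — contradiction.  So an's E-an-222ₒ `ShimuraThreeKernelForcesTwentySevenOpt ⟸ E-an-223 ∧ E-an-225 ∧ E-an-226 ∧ E-es-72`
  (`shimuraThreeKernelForcesTwentySevenOpt_of_laws`) no longer needs E-an-226 at `3 ∥ N` (feed this theorem where `_of_signLemmas` was used).
  E-an-226 `MuThreeSignAtThree` (the `μ₃` twin) is NOT proved here (it needs `det ρ̄₃ = ω` to produce the fixed vectors; the node above no
  longer depends on it).

HONEST FRAMING.  Unconditional tree theorems (standard axioms); no definition, no named fact, no `sorry`.  Nothing here touches `9 ∣ N`: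
C3 `ManinPrimeToThreeAtNine`, E-an-221, Manin's conjecture and BSD are NOT proved by this file.
References: [Katz1980] N. M. Katz, *Galois properties of torsion points on abelian varieties*, Invent. Math. 62 (1981), Thm. 2;
[SilvermanAEC2009] Thm. VII.6.1, Ex. 7.5, Ex. 8.19(a), §C.16; [AtkinLehner1970] Thm. 3; [Ribet1988Shimura]; [LingOesterle1991].
-/

set_option linter.dupNamespace false
set_option autoImplicit false

noncomputable section

open scoped Classical MatrixGroups ModularForm

open CongruenceSubgroup WeierstrassCurve Field IsDedekindDomain NumberField Rat.HeightOneSpectrum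
  Literature.NumberTheory.EllipticCurves
  Literature.NumberTheory.EllipticCurves.ModularForms
  Literature.NumberTheory.EllipticCurves.Rank1Residual
  Summit.BirchSwinnertonDyer.Rank1Residual
  Summit.BirchSwinnertonDyer.Rank1Residual.ManinAdditive
  Summit.BirchSwinnertonDyer.Rank1Residual.ManinAdditive.KatoCurve
  Summit.BirchSwinnertonDyer.Rank1Residual.ManinAdditive.HesseOptimality
  Summit.BirchSwinnertonDyer.Rank1Residual.ManinAdditive.CuspidalKummer
  Summit.BirchSwinnertonDyer.Rank1Residual.ManinAdditive.CuspidalKummerThree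

namespace Summit.BirchSwinnertonDyer.BirchSwinnertonDyer.Theorems.ManinLocalTwoThree.ShimuraIndexAtThree

/-- **A Galois-fixed non-zero `3`-torsion point for every `σ` forces SPLIT multiplicative reduction at a multiplicative `3`.**
If every `σ ∈ Γ_ℚ` fixes a non-zero point of `W[3]` (e.g. `W(ℚ)[3] ≠ 0`, or the Eisenstein congruences `a_ℓ ≡ ℓ + 1 (mod 3)`), then
by Katz's theorem (tree `exists_isogeny_addOrderOf_eq_of_forall_exists_smul_eq`) some `ℚ`-isogenous curve has a rational point of
order `3`, and rational `3`-torsion anywhere in the isogeny class forces split reduction at a multiplicative `3` (Tate uniformisation at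
`3`, tree `X2.hasSplitMultiplicativeReductionAtPrime_of_isIsogenous_of_dvd_torsionOrder`, read on a global minimal model of the target).
[cite: Katz1980, Thm. 2 (m = ℓ)] [cite: SilvermanAEC2009, Thm. VII.6.1 and Ex. 7.5] -/
theorem hasSplitMultiplicativeReductionAtPrime_three_of_forall_exists_smul_eq
    (W : WeierstrassCurve ℚ) [W.IsElliptic]
    (hfix : ∀ σ : absoluteGaloisGroup ℚ, ∃ P : W.geomTorsion 3, P ≠ 0 ∧ σ • P = P)
    (hmult : haveI := Fact.mk Nat.prime_three; W.HasMultiplicativeReductionAtPrime 3) :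
    haveI := Fact.mk Nat.prime_three; W.HasSplitMultiplicativeReductionAtPrime 3 := by
  haveI : Fact (Nat.Prime 3) := ⟨Nat.prime_three⟩
  obtain ⟨W', hW', g, -, Q, hQ⟩ := exists_isogeny_addOrderOf_eq_of_forall_exists_smul_eq W 3 hfix
  haveI := hW'
  obtain ⟨C, hmin'⟩ := hasGlobalMinimalModel_rat_holds W'
  haveI := hmin'
  have hfin : IsOfFinAddOrder Q := addOrderOf_pos_iff.mp (by rw [hQ]; norm_num)
  have htors : 3 ∣ (C • W').torsionOrder := by
    rw [torsionOrder_variableChange_holds W' C, ← hQ]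
    exact addOrderOf_dvd_torsionOrder W' hfin
  have hiso : IsIsogenous W (C • W') := IsIsogenous.trans' ⟨g⟩ (isIsogenous_smul W' C)
  exact X2.hasSplitMultiplicativeReductionAtPrime_of_isIsogenous_of_dvd_torsionOrder 3 le_rfl hmult hiso htors

/-- **A Shimura `3`-kernel forces SPLIT multiplicative reduction at every multiplicative `3`.**  For a globally minimal elliptic `W/ℚ`
with newform `f` (any level), if `3 ∣ [Λ₀(f) : Λ₁(f)]` (`¬ ShimuraIndexPrimeTo 3 f`) and `W` has multiplicative reduction at `3`,
then the reduction is SPLIT: the Eisenstein congruences `a_ℓ ≡ ℓ + 1 (mod 3)` (tree `dvd_frobeniusTrace_sub_of_not_shimuraIndexPrimeTo`)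
give, by Katz's theorem (tree `exists_isogeny_addOrderOf_eq_of_forall_exists_smul_eq`), a `ℚ`-isogenous curve with a rational point of
order `3`, and rational `3`-torsion anywhere in the isogeny class forces split reduction at a multiplicative `3` (Tate uniformisation,
tree `X2.hasSplitMultiplicativeReductionAtPrime_of_isIsogenous_of_dvd_torsionOrder`). [cite: Katz1980, Thm. 2 (m = ℓ)]
[cite: SilvermanAEC2009, Thm. VII.6.1 and Ex. 7.5] -/
theorem hasSplitMultiplicativeReductionAtPrime_three_of_not_shimuraIndexPrimeTo
    (W : WeierstrassCurve ℚ) [W.IsElliptic] [W.IsGloballyMinimal] {N : ℕ} [NeZero N]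
    {f : CuspForm (Gamma0 N) 2} (hf : IsNewformOf W f) (hS : ¬ ShimuraIndexPrimeTo 3 f)
    (hmult : haveI := Fact.mk Nat.prime_three; W.HasMultiplicativeReductionAtPrime 3) :
    haveI := Fact.mk Nat.prime_three; W.HasSplitMultiplicativeReductionAtPrime 3 := by
  haveI : Fact (Nat.Prime 3) := ⟨Nat.prime_three⟩
  -- every `σ ∈ Γ_ℚ` fixes a non-zero `3`-torsion point (Eisenstein congruences at all good primes)
  exact hasSplitMultiplicativeReductionAtPrime_three_of_forall_exists_smul_eq W
    (forall_exists_smul_eq_of_frobeniusTrace_congr W 3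
      (fun ℓ _ _ hgood ↦ dvd_frobeniusTrace_sub_of_not_shimuraIndexPrimeTo W hf Nat.prime_three hS hgood)) hmult

/-- **`3 ∥ N` (level): the curve is multiplicative at `3`.**  `3 ∣ N` puts `3` in the conductor (`IsNewformOf.dvd_level_iff_dvd_conductorNorm`),
so the reduction is bad; it is not additive, because then `a₃(W) = 0` (`LFunction_apply_primesEquiv_of_hasAdditiveReductionAt`) while
`a₃(f) = −λ₃(f) = ∓1` at `3 ∥ N` (Atkin–Lehner, tree `IsNewform0.atkinLehnerEigenvalueAt_eq_neg_coeff_of_not_dvd` /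
`…_eq_one_or_eq_neg_one`). No appeal to Carayol's level theorem. [cite: AtkinLehner1970, Thm. 3] [cite: SilvermanAEC2009, §C.16] -/
theorem hasMultiplicativeReductionAtPrime_three_of_three_exactly_dvd_level
    (W : WeierstrassCurve ℚ) [W.IsElliptic] {N : ℕ} [NeZero N]
    {f : CuspForm (Gamma0 N) 2} (hf : IsNewformOf W f) (h3 : 3 ∣ N) (h9 : ¬ 3 ^ 2 ∣ N) :
    haveI := Fact.mk Nat.prime_three; W.HasMultiplicativeReductionAtPrime 3 := by
  haveI : Fact (Nat.Prime 3) := ⟨Nat.prime_three⟩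
  set v : HeightOneSpectrum (𝓞 ℚ) := (primesEquiv (R := 𝓞 ℚ)).symm ⟨3, Nat.prime_three⟩ with hv
  have hpv : primesEquiv v = ⟨3, Nat.prime_three⟩ := (primesEquiv (R := 𝓞 ℚ)).apply_symm_apply _
  -- `λ₃(f) = −a₃(W)` and `λ₃ = ±1`
  obtain ⟨M, hNM⟩ := h3
  have h3M : ¬ 3 ∣ M := fun ⟨M', hM'⟩ ↦ h9 ⟨M', by rw [hNM, hM']; ring⟩
  have hlam : atkinLehnerEigenvalueAt f 3 = -((W.LFunction 3 : ℤ) : ℂ) := by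
    rw [hf.1.atkinLehnerEigenvalueAt_eq_neg_coeff_of_not_dvd 3 hNM h3M, ← hf.2 3]
    rfl
  have hpm := hf.1.atkinLehnerEigenvalueAt_eq_one_or_eq_neg_one Nat.prime_three ⟨M, hNM⟩
  have ha3 : W.LFunction 3 ≠ 0 := by
    intro h0
    rw [h0] at hlam
    norm_num at hlam
    rcases hpm with h | h <;> rw [hlam] at h <;> norm_num at h
  -- bad at `3`, not additive ⟹ multiplicative
  have h3N : 3 ∣ W.conductorNorm ℤ := (hf.dvd_level_iff_dvd_conductorNorm Nat.prime_three).mp ⟨M, hNM⟩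
  have hbad : ¬ W.HasGoodReductionAt v :=
    W.not_hasGoodReductionAt_ringOfIntegers_of_dvd_conductorNorm ⟨3, Nat.prime_three⟩ h3N
  rcases hasGoodReductionAt_or_hasMultiplicativeReductionAt_or_hasAdditiveReductionAt v W with hg | hm | ha
  · exact absurd hg hbad
  · have key := (W.hasMultiplicativeReductionAtPrime_iff_hasMultiplicativeReductionAt_ringOfIntegers v).mpr hm
    rw [hpv] at key
    exact key
  · exfalso
    have h0 := W.LFunction_apply_primesEquiv_of_hasAdditiveReductionAt ha
    rw [hpv] at h0
    exact ha3 h0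

/-- **`λ₃(f) = −1` from SPLIT multiplicative reduction at `3 ∥ N`** (`a₃(W) = +1`, Silverman Ex. 8.19(a); `λ₃ = −a₃`, Atkin–Lehner).
[cite: AtkinLehner1970, Thm. 3] [cite: SilvermanAEC2009, Exercise 8.19(a)] -/
theorem atkinLehnerEigenvalueAt_three_eq_neg_one_of_split (W : WeierstrassCurve ℚ) [W.IsElliptic] {N : ℕ} [NeZero N]
    {f : CuspForm (Gamma0 N) 2} (hf : IsNewformOf W f) (h3 : 3 ∣ N) (h9 : ¬ 3 ^ 2 ∣ N)
    (hsplit : haveI := Fact.mk Nat.prime_three; W.HasSplitMultiplicativeReductionAtPrime 3) :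
    atkinLehnerEigenvalueAt f 3 = -1 := by
  haveI : Fact (Nat.Prime 3) := ⟨Nat.prime_three⟩
  have ha3 : W.LFunction 3 = 1 := W.LFunction_apply_prime_of_hasSplitMultiplicativeReductionAtPrime 3 hsplit
  obtain ⟨M, hNM⟩ := h3
  have h3M : ¬ 3 ∣ M := fun ⟨M', hM'⟩ ↦ h9 ⟨M', by rw [hNM, hM']; ring⟩
  have hlam : atkinLehnerEigenvalueAt f 3 = -((W.LFunction 3 : ℤ) : ℂ) := by
    rw [hf.1.atkinLehnerEigenvalueAt_eq_neg_coeff_of_not_dvd 3 hNM h3M, ← hf.2 3]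
    rfl
  rw [hlam, ha3]; norm_num

/-! ## §2 E-an-226♮ `ThreeTorsionSignAtThree` BY NAME, unconditionally -/

/-- Rescaling a rational point of order `3` from the short model `E_{W,c}` to `E_{W,1}`: `(X₀, Y₀) ↦ (X₀/c², Y₀/c³)`
(`a₄^{(c)} = c⁴a₄^{(1)}`, `a₆^{(c)} = c⁶a₆^{(1)}`, `Ψ₃^{(c)}(c²x) = c⁸Ψ₃^{(1)}(x)`). [cite: SilvermanAEC2009, III.1 and Exercise 3.7] -/
theorem isShortThreeTorsion_one_of_isShortThreeTorsion (W : WeierstrassCurve ℚ) [W.IsElliptic] {c : ℤ} (hc : c ≠ 0)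
    {X₀ Y₀ : ℚ} (hT : IsShortThreeTorsion W c X₀ Y₀) :
    IsShortThreeTorsion W 1 (X₀ / (c : ℚ) ^ 2) (Y₀ / (c : ℚ) ^ 3) := by
  have hcQ : (c : ℚ) ≠ 0 := Int.cast_ne_zero.mpr hc
  have heq := equation_of_isShortThreeTorsion hT
  have hΨ := (isRoot_Ψ₃_shortModel_iff W c X₀).mp hT.2
  have ha4 : (shortModel W c).a₄ = (c : ℚ) ^ 4 * (shortModel W 1).a₄ := by simp [shortModel]; ring
  have ha6 : (shortModel W c).a₆ = (c : ℚ) ^ 6 * (shortModel W 1).a₆ := by simp [shortModel]; ring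
  rw [ha4, ha6] at heq hΨ
  haveI : (shortModel W 1).IsElliptic :=
    ⟨isUnit_iff_ne_zero.mpr (by rw [shortModel_Δ]; simpa using W.isUnit_Δ.ne_zero)⟩
  have h1 : (shortModel W 1).a₁ = 0 := rfl
  have h2 : (shortModel W 1).a₂ = 0 := rfl
  have h3 : (shortModel W 1).a₃ = 0 := rfl
  refine ⟨(WeierstrassCurve.Affine.equation_iff_nonsingular).mp ?_, ?_⟩
  · rw [WeierstrassCurve.Affine.equation_iff, h1, h2, h3]
    field_simp
    linear_combination heq
  · rw [isRoot_Ψ₃_shortModel_iff]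
    field_simp
    linear_combination hΨ

/-- **A rational point of order `3` on `E_{W,c}` makes every `σ ∈ Γ_ℚ` fix a non-zero point of `W[3]`** (the corresponding rational point
of `W`, tree `exists_geomPoint_of_isShortThreeTorsion`). [cite: SilvermanAEC2009, Exercise 3.7] -/
theorem forall_exists_smul_eq_of_isShortThreeTorsion (W : WeierstrassCurve ℚ) [W.IsElliptic] {c : ℤ} (hc : c ≠ 0)
    {X₀ Y₀ : ℚ} (hT : IsShortThreeTorsion W c X₀ Y₀) :
    ∀ σ : absoluteGaloisGroup ℚ, ∃ P : W.geomTorsion 3, P ≠ 0 ∧ σ • P = P := by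
  obtain ⟨hns, P₀, hP₀, hfix, hord⟩ :=
    exists_geomPoint_of_isShortThreeTorsion W (isShortThreeTorsion_one_of_isShortThreeTorsion W hc hT)
  have hmem : P₀ ∈ W.geomTorsion 3 := by
    have h : (3 : ℕ) • P₀ = 0 := by rw [← hord]; exact addOrderOf_nsmul_eq_zero P₀
    have h' : (3 : ℤ) • P₀ = 0 := by exact_mod_cast h
    exact (Submodule.mem_torsionBy_iff (3 : ℤ) P₀).mpr h'
  have hne : (⟨P₀, hmem⟩ : W.geomTorsion 3) ≠ 0 := by
    intro h
    have h0 : P₀ = 0 := congrArg Subtype.val h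
    rw [h0, addOrderOf_zero] at hord
    exact absurd hord (by norm_num)
  exact fun σ ↦ ⟨⟨P₀, hmem⟩, hne, Subtype.ext (hfix σ)⟩

/-- **E-an-226♮ `ThreeTorsionSignAtThree` HOLDS, unconditionally** (an g40's «printed-derivable local sign lemma»): `3 ∥ N` and a rational
point of order `3` on `E_{W,c}` ⟹ `λ₃(f) = −1` — the reduction at `3` is multiplicative (`3 ∥ N`), rational `3`-torsion forces it SPLIT
(Tate curve over `ℚ₃`: `#Ẽ_ns(𝔽₃) = 4`, `Φ ≤ ℤ/2`, `Ê(3ℤ₃)` torsion-free at a non-split `3`), so `a₃ = +1` and `λ₃ = −a₃ = −1`.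
[cite: AtkinLehner1970, Thm. 3] [cite: SilvermanAEC2009, Thm. VII.6.1 and Ex. 7.5] -/
theorem threeTorsionSignAtThree_holds : ThreeTorsionSignAtThree := by
  intro W _ _ N _ D h3 h9 hT
  obtain ⟨X₀, Y₀, hT⟩ := hT
  haveI : Fact (Nat.Prime 3) := ⟨Nat.prime_three⟩
  have hmult := hasMultiplicativeReductionAtPrime_three_of_three_exactly_dvd_level W D.isNewformOf h3 h9
  exact atkinLehnerEigenvalueAt_three_eq_neg_one_of_split W D.isNewformOf h3 h9
    (hasSplitMultiplicativeReductionAtPrime_three_of_forall_exists_smul_eq W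
      (forall_exists_smul_eq_of_isShortThreeTorsion W D.maninConstant_ne_zero_holds hT) hmult)

/-! ## §3 The restriction node `ShimuraIndexPrimeToThreeAtMultiplicativeThree` BY NAME, unconditionally -/

/-- **`ShimuraIndexPrimeToThreeAtMultiplicativeThree` HOLDS — at `3 ∥ N` NO elliptic newform has a Shimura `3`-kernel**
(an g40's restriction node of `ManinAdditive/HesseOptimalityAtThree.lean`, previously «closed modulo the two local sign lemmas E-an-226 /
E-an-226♮»; here UNCONDITIONAL, for every modular parametrisation datum, no optimality): a Shimura `3`-kernel would force split
multiplicative reduction at `3` (`hasSplitMultiplicativeReductionAtPrime_three_of_not_shimuraIndexPrimeTo`), i.e. `a₃(W) = +1`,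
`λ₃(f) = −1`, and then es's THEOREM AL₍₃₎ (`shimuraIndexPrimeTo_of_atkinLehnerEigenvalueAt_eq_neg_one`, `27 ∤ N`) gives `3 ∤ [Λ₀ : Λ₁]` —
contradiction. [cite: Katz1980, Thm. 2 (m = ℓ)] [cite: SilvermanAEC2009, Thm. VII.6.1] [cite: AtkinLehner1970, Thm. 3] -/
theorem shimuraIndexPrimeToThreeAtMultiplicativeThree_holds : ShimuraIndexPrimeToThreeAtMultiplicativeThree := by
  intro W _ _ N _ D h3 h9
  haveI : Fact (Nat.Prime 3) := ⟨Nat.prime_three⟩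
  have h27 : ¬ 3 ^ 3 ∣ N := fun h ↦ h9 ((pow_dvd_pow 3 (by norm_num : 2 ≤ 3)).trans h)
  by_contra hS
  have hmult := hasMultiplicativeReductionAtPrime_three_of_three_exactly_dvd_level W D.isNewformOf h3 h9
  have hε := atkinLehnerEigenvalueAt_three_eq_neg_one_of_split W D.isNewformOf h3 h9
    (hasSplitMultiplicativeReductionAtPrime_three_of_not_shimuraIndexPrimeTo W D.isNewformOf hS hmult)
  exact hS (shimuraIndexPrimeTo_of_atkinLehnerEigenvalueAt_eq_neg_one D.f Nat.prime_three (by decide) h3 h27 hε)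

end Summit.BirchSwinnertonDyer.BirchSwinnertonDyer.Theorems.ManinLocalTwoThree.ShimuraIndexAtThree

end
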